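import Mathlib
import HarnessLib
import Literature.Probability.Percolation.MinOpenCut

/-!
# `stub_superadditive` of line `Sketch` (crux `BudgetTightness`, stmt-CriticalPhenomena-5248):
# lateral superadditivity of the bottom-to-top min-cut of slab pieces

Registered stub `stub_superadditive` of the lead's skeleton `Cruxes/BudgetTightness/Lines/Sketch.lean`,
restated DEF-FREE over tree declarations and proved here (`--supports stmt-CriticalPhenomena-5248`).

With `S(Q)(ω) = minOpenCutIn Q bottom(Q) top(Q) ω` the bottom-to-top min-cut budget of a slab piece
`Q = [x₀, x₁] × [y₀, y₁] × [0, h] ⊆ ℤ³` (`MinOpenCut.lean`), the `k²` translates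
`Q_{a,b} = [(L+1)a, (L+1)a+L] × [(L+1)b, (L+1)b+L] × [0, h]`, `a, b < k`, are pairwise disjoint
full-height sub-pieces of the big piece `Q' = [0, k(L+1)-1]² × [0, h]`, with bottoms inside the
bottom of `Q'` and tops inside its top. POINTWISE, for every configuration `ω`:
`Σ_{a,b<k} S(Q_{a,b})(ω) ≤ S(Q')(ω)`.

Proof. If `S(Q')(ω) = ⊤` there is nothing to prove. Otherwise let `T` be an optimal finite open
cutset of `Q'` (`exists_eq_minOpenCutIn`). Its restriction `T ∩ Sym2(Q_{a,b})` to the pairs inside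
`Q_{a,b}` is an open cutset of `Q_{a,b}` (`IsOpenCutsetIn.anti_set`, `.anti`,
`isOpenCutsetIn_inter_sym2_iff`), so `S(Q_{a,b})(ω) ≤ #(T ∩ Sym2(Q_{a,b}))` (`minOpenCutIn_le_card`);
the restrictions are pairwise disjoint sub-finsets of `T` (the pieces are disjoint), so their sizes
add up to at most `#T = S(Q')(ω)` (`Finset.card_biUnion`, `Finset.card_le_card`).
The abstract statement is `StubSuperadditive.sum_minOpenCutIn_le` (any finite family of pairwise
disjoint sub-regions with sources/sinks inside those of the big region); the rest is the
coordinate arithmetic of the pieces.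
-/

noncomputable section

namespace Summit.CriticalPhenomena.PercolationContinuityZ3.Theorems.BudgetTightness

open Literature.Probability.Percolation Literature.Probability.LatticeModels

namespace StubSuperadditive

/-- **Abstract superadditivity of the min-cut budget over disjoint sub-regions.** If the regions
`S i`, `i ∈ s`, are pairwise disjoint subsets of `S'` with `A i ⊆ A'`, `B i ⊆ B'`, then
`∑_{i ∈ s} MinCut_{S i}(A i, B i)(ω) ≤ MinCut_{S'}(A', B')(ω)` for every configuration `ω`:
an optimal open cutset of the big region restricted to the pairs inside `S i` is an open cutset
of the `i`-th piece, and these restrictions are pairwise disjoint. -/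
theorem sum_minOpenCutIn_le {V ι : Type*} {s : Finset ι} {S A B : ι → Set V}
    {S' A' B' : Set V} {ω : BondConfig V}
    (hS : ∀ i ∈ s, S i ⊆ S') (hA : ∀ i ∈ s, A i ⊆ A') (hB : ∀ i ∈ s, B i ⊆ B')
    (hdisj : ∀ i ∈ s, ∀ j ∈ s, i ≠ j → Disjoint (S i) (S j)) :
    ∑ i ∈ s, minOpenCutIn (S i) (A i) (B i) ω ≤ minOpenCutIn S' A' B' ω := by
  classical
  by_cases htop : minOpenCutIn S' A' B' ω = ⊤
  · rw [htop]; exact le_top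
  obtain ⟨T, hT, hcard⟩ := exists_eq_minOpenCutIn htop
  rw [← hcard]
  have hcut : ∀ i ∈ s,
      IsOpenCutsetIn (S i) (A i) (B i) ω ↑(T.filter (fun e => e ∈ (S i).sym2)) := by
    intro i hi
    have hset : (↑(T.filter (fun e => e ∈ (S i).sym2)) : Set (Sym2 V)) = ↑T ∩ (S i).sym2 := by
      ext e
      simp only [Finset.coe_filter, Set.mem_setOf_eq, Set.mem_inter_iff, Finset.mem_coe]
    rw [hset]
    exact isOpenCutsetIn_inter_sym2_iff.2 ((hT.anti_set (hS i hi)).anti (hA i hi) (hB i hi))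
  have hdisjT : (↑s : Set ι).PairwiseDisjoint (fun i => T.filter (fun e => e ∈ (S i).sym2)) := by
    intro i hi j hj hij
    rw [Function.onFun, Finset.disjoint_filter]
    intro e _ hei hej
    induction e using Sym2.ind with
    | h u v =>
      rw [Set.mk_mem_sym2_iff] at hei hej
      exact Set.disjoint_left.1 (hdisj i hi j hj hij) hei.1 hej.1
  calc ∑ i ∈ s, minOpenCutIn (S i) (A i) (B i) ω
      ≤ ∑ i ∈ s, ((T.filter (fun e => e ∈ (S i).sym2)).card : ℕ∞) :=
        Finset.sum_le_sum fun i hi => minOpenCutIn_le_card (hcut i hi)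
    _ = ((∑ i ∈ s, (T.filter (fun e => e ∈ (S i).sym2)).card : ℕ) : ℕ∞) := by rw [Nat.cast_sum]
    _ = ((s.biUnion (fun i => T.filter (fun e => e ∈ (S i).sym2))).card : ℕ∞) := by
        rw [Finset.card_biUnion hdisjT]
    _ ≤ (T.card : ℕ∞) := by
        exact_mod_cast Finset.card_le_card
          (Finset.biUnion_subset.2 fun i _ => Finset.filter_subset _ _)

/-- Doubly indexed form of `sum_minOpenCutIn_le` (pieces indexed by `a ∈ s`, `b ∈ t`). -/
theorem sum_sum_minOpenCutIn_le {V α β : Type*} {s : Finset α} {t : Finset β}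
    {S A B : α → β → Set V} {S' A' B' : Set V} {ω : BondConfig V}
    (hS : ∀ a ∈ s, ∀ b ∈ t, S a b ⊆ S') (hA : ∀ a ∈ s, ∀ b ∈ t, A a b ⊆ A')
    (hB : ∀ a ∈ s, ∀ b ∈ t, B a b ⊆ B')
    (hdisj : ∀ a ∈ s, ∀ b ∈ t, ∀ a' ∈ s, ∀ b' ∈ t, (a ≠ a' ∨ b ≠ b') →
      Disjoint (S a b) (S a' b')) :
    ∑ a ∈ s, ∑ b ∈ t, minOpenCutIn (S a b) (A a b) (B a b) ω ≤ minOpenCutIn S' A' B' ω := by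
  rw [← Finset.sum_product']
  refine sum_minOpenCutIn_le (fun p hp => ?_) (fun p hp => ?_) (fun p hp => ?_)
    (fun p hp q hq hpq => ?_)
  · exact hS p.1 (Finset.mem_product.1 hp).1 p.2 (Finset.mem_product.1 hp).2
  · exact hA p.1 (Finset.mem_product.1 hp).1 p.2 (Finset.mem_product.1 hp).2
  · exact hB p.1 (Finset.mem_product.1 hp).1 p.2 (Finset.mem_product.1 hp).2
  · refine hdisj p.1 (Finset.mem_product.1 hp).1 p.2 (Finset.mem_product.1 hp).2
      q.1 (Finset.mem_product.1 hq).1 q.2 (Finset.mem_product.1 hq).2 ?_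
    by_contra hcon
    push Not at hcon
    exact hpq (Prod.ext hcon.1 hcon.2)

/-! ### Coordinate arithmetic of the pieces -/

/-- For `a < k` the `a`-th lateral block `[(L+1)a, (L+1)a+L]` ends at or before `k(L+1)-1`. -/
theorem block_end_le {L a k : ℕ} (ha : a < k) : (L + 1) * a + L ≤ k * (L + 1) - 1 := by
  have h1 : (L + 1) * (a + 1) ≤ (L + 1) * k := Nat.mul_le_mul_left _ ha
  rw [Nat.mul_succ] at h1
  rw [Nat.mul_comm k]
  omega

/-- Two lateral blocks `[(L+1)a, (L+1)a+L]` and `[(L+1)a', (L+1)a'+L]` that share an integer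
point have the same index. -/
theorem eq_of_blocks_meet {L a a' : ℕ} {z : ℤ} (h1 : ((L : ℤ) + 1) * a ≤ z)
    (h2 : z ≤ ((L : ℤ) + 1) * a + L) (h3 : ((L : ℤ) + 1) * a' ≤ z)
    (h4 : z ≤ ((L : ℤ) + 1) * a' + L) : a = a' := by
  have hpos : (0 : ℤ) ≤ (L : ℤ) + 1 := by positivity
  have key1 : ((L : ℤ) + 1) * a < ((L : ℤ) + 1) * ((a' : ℤ) + 1) := by linarith
  have key2 : ((L : ℤ) + 1) * a' < ((L : ℤ) + 1) * ((a : ℤ) + 1) := by linarith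
  have c1 := lt_of_mul_lt_mul_left key1 hpos
  have c2 := lt_of_mul_lt_mul_left key2 hpos
  omega

/-- The piece `Q_{a,b}` (third coordinate range `[lo, hi]`) lies in the big piece
`[0, k(L+1)-1]² × [lo, hi]` when `a, b < k`. -/
theorem piece_subset {L k a b : ℕ} (ha : a < k) (hb : b < k) (lo hi : ℤ) :
    (Set.Icc (![(((L + 1) * a : ℕ) : ℤ), (((L + 1) * b : ℕ) : ℤ), lo] : Site 3)
        ![(((L + 1) * a + L : ℕ) : ℤ), (((L + 1) * b + L : ℕ) : ℤ), hi]) ⊆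
      Set.Icc (![0, 0, lo] : Site 3)
        ![((k * (L + 1) - 1 : ℕ) : ℤ), ((k * (L + 1) - 1 : ℕ) : ℤ), hi] := by
  have hak : (((L + 1) * a + L : ℕ) : ℤ) ≤ ((k * (L + 1) - 1 : ℕ) : ℤ) :=
    Nat.cast_le.2 (block_end_le ha)
  have hbk : (((L + 1) * b + L : ℕ) : ℤ) ≤ ((k * (L + 1) - 1 : ℕ) : ℤ) :=
    Nat.cast_le.2 (block_end_le hb)
  have ha0 : (0 : ℤ) ≤ (((L + 1) * a : ℕ) : ℤ) := Nat.cast_nonneg _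
  have hb0 : (0 : ℤ) ≤ (((L + 1) * b : ℕ) : ℤ) := Nat.cast_nonneg _
  intro x hx
  have h0 : (((L + 1) * a : ℕ) : ℤ) ≤ x 0 := hx.1 0
  have h1 : (((L + 1) * b : ℕ) : ℤ) ≤ x 1 := hx.1 1
  have h2 : lo ≤ x 2 := hx.1 2
  have h0' : x 0 ≤ (((L + 1) * a + L : ℕ) : ℤ) := hx.2 0
  have h1' : x 1 ≤ (((L + 1) * b + L : ℕ) : ℤ) := hx.2 1
  have h2' : x 2 ≤ hi := hx.2 2
  refine ⟨fun i => ?_, fun i => ?_⟩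
  · fin_cases i
    · exact ha0.trans h0
    · exact hb0.trans h1
    · exact h2
  · fin_cases i
    · exact h0'.trans hak
    · exact h1'.trans hbk
    · exact h2'

/-- Distinct pieces `Q_{a,b}`, `Q_{a',b'}` (same third coordinate range) are disjoint. -/
theorem piece_disjoint {L a b a' b' : ℕ} (hne : a ≠ a' ∨ b ≠ b') (lo hi : ℤ) :
    Disjoint (Set.Icc (![(((L + 1) * a : ℕ) : ℤ), (((L + 1) * b : ℕ) : ℤ), lo] : Site 3)
        ![(((L + 1) * a + L : ℕ) : ℤ), (((L + 1) * b + L : ℕ) : ℤ), hi])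
      (Set.Icc (![(((L + 1) * a' : ℕ) : ℤ), (((L + 1) * b' : ℕ) : ℤ), lo] : Site 3)
        ![(((L + 1) * a' + L : ℕ) : ℤ), (((L + 1) * b' + L : ℕ) : ℤ), hi]) := by
  refine Set.disjoint_left.2 fun x hx hx' => ?_
  have h0 : (((L + 1) * a : ℕ) : ℤ) ≤ x 0 := hx.1 0
  have h1 : (((L + 1) * b : ℕ) : ℤ) ≤ x 1 := hx.1 1
  have h0' : x 0 ≤ (((L + 1) * a + L : ℕ) : ℤ) := hx.2 0
  have h1' : x 1 ≤ (((L + 1) * b + L : ℕ) : ℤ) := hx.2 1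
  have g0 : (((L + 1) * a' : ℕ) : ℤ) ≤ x 0 := hx'.1 0
  have g1 : (((L + 1) * b' : ℕ) : ℤ) ≤ x 1 := hx'.1 1
  have g0' : x 0 ≤ (((L + 1) * a' + L : ℕ) : ℤ) := hx'.2 0
  have g1' : x 1 ≤ (((L + 1) * b' + L : ℕ) : ℤ) := hx'.2 1
  push_cast at h0 h1 h0' h1' g0 g1 g0' g1'
  rcases hne with hne | hne
  · exact hne (eq_of_blocks_meet h0 h0' g0 g0')
  · exact hne (eq_of_blocks_meet h1 h1' g1 g1')

end StubSuperadditive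

/-- **`stub_superadditive`** (lateral superadditivity of the slab min-cut, pointwise for EVERY
configuration): the `k²` pieces `Q_{a,b} = ((L+1)a, (L+1)b, 0) + [0,L]²×[0,h]`, `a, b < k`, are
pairwise disjoint full-height sub-pieces of `Q' = [0, k(L+1)-1]² × [0, h]`, with bottoms in the
bottom and tops in the top of `Q'`; restricting an optimal open cutset of `Q'` to the pairs inside
each piece gives pairwise disjoint open cutsets of the pieces, so
`Σ_{a,b<k} S(Q_{a,b})(ω) ≤ S(Q')(ω)` (if `S(Q')(ω) = ⊤` there is nothing to prove). -/
theorem stub_superadditive :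
    ∀ (L h k : ℕ) (ω : BondConfig (Site 3)),
      ∑ a ∈ Finset.range k, ∑ b ∈ Finset.range k,
        minOpenCutIn
          (Set.Icc (![(((L + 1) * a : ℕ) : ℤ), (((L + 1) * b : ℕ) : ℤ), 0] : Site 3)
            ![(((L + 1) * a + L : ℕ) : ℤ), (((L + 1) * b + L : ℕ) : ℤ), (h : ℤ)])
          (Set.Icc (![(((L + 1) * a : ℕ) : ℤ), (((L + 1) * b : ℕ) : ℤ), 0] : Site 3)
            ![(((L + 1) * a + L : ℕ) : ℤ), (((L + 1) * b + L : ℕ) : ℤ), 0])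
          (Set.Icc (![(((L + 1) * a : ℕ) : ℤ), (((L + 1) * b : ℕ) : ℤ), (h : ℤ)] : Site 3)
            ![(((L + 1) * a + L : ℕ) : ℤ), (((L + 1) * b + L : ℕ) : ℤ), (h : ℤ)]) ω ≤
      minOpenCutIn
          (Set.Icc (![0, 0, 0] : Site 3)
            ![((k * (L + 1) - 1 : ℕ) : ℤ), ((k * (L + 1) - 1 : ℕ) : ℤ), (h : ℤ)])
          (Set.Icc (![0, 0, 0] : Site 3)
            ![((k * (L + 1) - 1 : ℕ) : ℤ), ((k * (L + 1) - 1 : ℕ) : ℤ), 0])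
          (Set.Icc (![0, 0, (h : ℤ)] : Site 3)
            ![((k * (L + 1) - 1 : ℕ) : ℤ), ((k * (L + 1) - 1 : ℕ) : ℤ), (h : ℤ)]) ω := by
  intro L h k ω
  refine StubSuperadditive.sum_sum_minOpenCutIn_le (fun a ha b hb => ?_) (fun a ha b hb => ?_)
    (fun a ha b hb => ?_) (fun a _ b _ a' _ b' _ hne => ?_)
  · exact StubSuperadditive.piece_subset (Finset.mem_range.1 ha) (Finset.mem_range.1 hb) 0 (h : ℤ)
  · exact StubSuperadditive.piece_subset (Finset.mem_range.1 ha) (Finset.mem_range.1 hb) 0 0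
  · exact StubSuperadditive.piece_subset (Finset.mem_range.1 ha) (Finset.mem_range.1 hb)
      (h : ℤ) (h : ℤ)
  · exact StubSuperadditive.piece_disjoint hne 0 (h : ℤ)

end Summit.CriticalPhenomena.PercolationContinuityZ3.Theorems.BudgetTightness

end
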